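import Summits.ABC.IUTFork.MLFGaloisTFG
import Literature.AnabelianGeometry.AbsoluteAnabelian.MLFGaloisPrimeToPStronglyComplete
import HarnessLib

/-!
# The tame quotient of `G_k` is strongly complete; `G_k` is strongly complete away from `p` —
# UNCONDITIONAL (abc-iut GAP-LEDGER row G-L3d2g2-1, the `G_k` instance of F-1977)

Cell `abc-iut` (run/shared/lean/pub/abc-iut/).  The Literature files
`MLFGaloisTameStronglyComplete.lean` / `MLFGaloisPrimeToPStronglyComplete.lean` (seat w5-d200) prove,
for a non-archimedean local field `F` whose absolute Galois group `Γ_F` is topologically finitely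
generated, that every finite-index subgroup of `Γ_F` containing the wild inertia group
`P_F = absWildInertia F ϖ` is open, that every normal subgroup of finite index prime to `p` is open, and
that every homomorphism to a finite group of order prime to `p` is continuous.  The hypothesis "`Γ_F`
topologically finitely generated" is a theorem for `F` of characteristic `0`, but only Summits-side
(`isTopologicallyFinitelyGenerated_absoluteGaloisGroup_local`, this directory's `MLFGaloisTFG.lean`, via
the tree's Tate Euler–Poincaré characteristic); the unconditional statements are assembled HERE:

* `isOpen_of_finiteIndex_of_absWildInertia_le_local` — **every finite-index subgroup of `Γ_F`
  containing `P_F` is open** (`F` a non-archimedean local field of characteristic `0`, `ϖ` a uniformiser);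
* `isOpen_of_normal_of_index_coprime_local` — **every normal subgroup of `Γ_F` of finite index prime to
  `p` is open**;
* `continuous_of_card_coprime_local` — **every homomorphism `Γ_F → H` to a finite discrete group of
  order prime to `p` is continuous**.

What this is NOT: the full strong completeness of `Γ_F` («every finite-index subgroup is open», the
instance of the Nikolov–Segal fact F-1977 consumed by the cone at `G_k`) — the residual is exactly the
wild `p`-part (finite `Γ_F`-normal abstract quotients of `P_F` that are `p`-groups), recorded in
plan/GAP-LEDGER.md D-G-L3d2g2-1.  HONEST FRAMING: classical local theory (Serre, *Local Fields* IV §2);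
nothing here asserts anything about abc or takes a side on [IUTchIII] Cor. 3.12.

## References

* J.-P. Serre, *Local Fields*, GTM 67 (1979), Ch. IV §2. [SerreLocalFields1979]
* J. Neukirch, A. Schmidt, K. Wingberg, *Cohomology of Number Fields* (2008), Thm. 7.5.10.
  [NeukirchSchmidtWingberg2008]
-/

noncomputable section

namespace Summit.ABC.IUTFork

open Field ValuativeRel Literature.AnabelianGeometry.AbsoluteAnabelian Literature.NumberTheory.GaloisRepresentations
open scoped Valued

/-- **Every finite-index subgroup of `Γ_F` containing the wild inertia group `P_F` is open**, for every
non-archimedean local field `F` of characteristic `0` and uniformiser `ϖ` — unconditional (the tame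
quotient `Γ_F ⧸ P_F` is strongly complete). [cite: SerreLocalFields1979, Ch. IV §2 Cor. 1 and Cor. 3 of Prop. 7]
[cite: NeukirchSchmidtWingberg2008, Thm. 7.5.10] -/
theorem isOpen_of_finiteIndex_of_absWildInertia_le_local (F : Type) [Field F] [ValuativeRel F]
    [TopologicalSpace F] [IsNonarchimedeanLocalField F] [CharZero F] {ϖ : 𝒪[F]} (hϖ : Irreducible ϖ)
    (K : Subgroup (absoluteGaloisGroup F)) [K.FiniteIndex] (hPK : absWildInertia F ϖ ≤ K) :
    IsOpen (K : Set (absoluteGaloisGroup F)) :=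
  MLFGaloisTameStronglyComplete.isOpen_of_finiteIndex_of_absWildInertia_le F
    (isTopologicallyFinitelyGenerated_absoluteGaloisGroup_local F) hϖ K hPK

/-- **Every normal subgroup of `Γ_F` of finite index prime to `p = char 𝓀[F]` is open**, for every
non-archimedean local field `F` of characteristic `0` — unconditional.
[cite: SerreLocalFields1979, Ch. IV §2 Cor. 1 and Cor. 3 of Prop. 7] [cite: NeukirchSchmidtWingberg2008, Thm. 7.5.10] -/
theorem isOpen_of_normal_of_index_coprime_local (F : Type) [Field F] [ValuativeRel F]
    [TopologicalSpace F] [IsNonarchimedeanLocalField F] [CharZero F]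
    (N : Subgroup (absoluteGaloisGroup F)) [N.Normal] [N.FiniteIndex]
    (hN : (ringChar 𝓀[F]).Coprime N.index) : IsOpen (N : Set (absoluteGaloisGroup F)) :=
  MLFGaloisTameStronglyComplete.isOpen_of_normal_of_index_coprime' F
    (isTopologicallyFinitelyGenerated_absoluteGaloisGroup_local F) N hN

/-- **Every homomorphism from `Γ_F` to a finite discrete group of order prime to `p` is continuous**,
for every non-archimedean local field `F` of characteristic `0` — unconditional («`Γ_F` is strongly
complete away from `p`»). [cite: SerreLocalFields1979, Ch. IV §2 Cor. 1 and Cor. 3 of Prop. 7]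
[cite: NeukirchSchmidtWingberg2008, Thm. 7.5.10] -/
theorem continuous_of_card_coprime_local (F : Type) [Field F] [ValuativeRel F]
    [TopologicalSpace F] [IsNonarchimedeanLocalField F] [CharZero F]
    {H : Type*} [Group H] [Finite H] [TopologicalSpace H] [DiscreteTopology H]
    (f : absoluteGaloisGroup F →* H) (hH : (ringChar 𝓀[F]).Coprime (Nat.card H)) : Continuous f :=
  MLFGaloisTameStronglyComplete.continuous_of_card_coprime F
    (isTopologicallyFinitelyGenerated_absoluteGaloisGroup_local F) f hH

end Summit.ABC.IUTFork

end
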